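import Summits.Ventures.DiscreteObjects.Hadamard.Order666Excluded668
import Summits.Ventures.DiscreteObjects.Hadamard.Order167CirculantArray668
import Summits.Ventures.DiscreteObjects.Hadamard.ElemAbelianAction

/-!
# H(668): an automorphism of order 333 is SELF-CENTRALISING (kernel) — nothing commutes with the LP(333) core shift but its powers

Framing: lottery ticket; floor = certified bounds/negative ranges.

Cell pub-namedobj (venture DiscreteObjects), target (H), hadamard gen 19.  Let `σ = (π, κ, d, e)` be a signed automorphism of a
Hadamard matrix of order `668` of pair order `333` and `τ = (π', κ', d', e')` ANY signed automorphism whose permutation pair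
commutes with that of `σ` (`π'π = ππ'`, `κ'κ = κκ'`).  Then **`(π', κ') = (π^c, κ^c)` for some `c`**
(`hadamard668_order333_self_centralizing`): the centraliser of `σ` in the group of permutation pairs of signed automorphisms is
`⟨σ⟩` (so in `Aut±` it is `±⟨σ⟩`).  Proof.  (1) Orbit type (gen 19): `π` fixes a 2-set `F` and is free of period `333` on two
regular orbits.  `π'` permutes `F` (so `π'² = 1` on `F`) and permutes the two orbits; by pigeonhole on `x₀, π'x₀, π'²x₀`,
`π'² x₀ = π^c x₀`, hence `π'² = π^c` on the orbit of `x₀` and `π'⁴ = π^{2c}` there.  (2) The signed automorphism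
`Ψ = τ⁴ σ^m`, `π^{2c+m} = 1`, has row part fixing `F` and that orbit (`335` rows) and is a power of `π` resp. `κ` on every orbit,
so its pair order divides `333`; a power of pair order `37` would fix exactly `2` rows (gen 6) and one of pair order `3` at most
`164` (gen 8 census) or have trivial row part and then trivial column part (gen 6) — so `Ψ = 1`: `π'⁴ = π^a`, `κ'⁴ = κ^a`.
(3) With `4b ≡ −a (mod 333)`, `ν = τσ^b` has `(pair ν)⁴ = 1`; a non-trivial `ν²` or `ν` would be an involution pair commuting
with `σ`, whose product with `σ` has pair order `666` — excluded (`Order666Excluded668`).  So `(π', κ') = (π, κ)^{−b}`: any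
H(668) with an element of order 333 (e.g. from an LP(333)) has no automorphism commuting with it but its powers (and signs).
Structure of a hypothetical object; H(668) untouched.  Ours; no `sorry`.
-/

namespace Summit.Ventures.DiscreteObjects.Hadamard

open Finset BigOperators Matrix

open Literature.Combinatorics.Designs.GoethalsSeidel (IsHadamardMatrix)

variable {ι : Type*} [Fintype ι] [DecidableEq ι]

/-! ### permutations commuting with a permutation of orbit type `2 + 333 + 333` -/

section perm
variable {π ψ : Equiv.Perm ι} (hc : Commute ψ π)
include hc

omit [Fintype ι] [DecidableEq ι] in
/-- a commuting permutation that agrees with `π^c` at `x` agrees with it on the whole `π`-orbit of `x` -/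
lemma comm_apply_pow_orbit {x : ι} {c : ℕ} (h : ψ x = (π ^ c) x) (k : ℕ) : ψ ((π ^ k) x) = (π ^ c) ((π ^ k) x) := by
  have h1 : ψ ((π ^ k) x) = (π ^ k) (ψ x) := by
    rw [← Equiv.Perm.mul_apply, ← Equiv.Perm.mul_apply, (hc.pow_right k).eq]
  rw [h1, h, ← Equiv.Perm.mul_apply, ← Equiv.Perm.mul_apply, ← pow_add, ← pow_add, add_comm]

omit [Fintype ι] [DecidableEq ι] in
/-- powers: if `ψ = π^c` on the orbit of `x` then `ψ^n = π^(n c)` there -/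
lemma comm_pow_apply_pow_orbit {x : ι} {c : ℕ} (h : ψ x = (π ^ c) x) (n k : ℕ) :
    (ψ ^ n) ((π ^ k) x) = (π ^ (n * c)) ((π ^ k) x) := by
  induction n with
  | zero => simp
  | succ n ih =>
    rw [pow_succ', Equiv.Perm.mul_apply, ih, ← Equiv.Perm.mul_apply (π ^ (n * c)), ← pow_add,
      comm_apply_pow_orbit hc h, ← Equiv.Perm.mul_apply, ← pow_add, ← Equiv.Perm.mul_apply, ← pow_add]
    congr 2
    ring

omit [Fintype ι] [DecidableEq ι] in
/-- a commuting permutation preserves (non-)fixedness -/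
lemma comm_moved_iff (x : ι) : π (ψ x) ≠ ψ x ↔ π x ≠ x := by
  have : π (ψ x) = ψ (π x) := by rw [← Equiv.Perm.mul_apply, ← hc.eq, Equiv.Perm.mul_apply]
  rw [this]
  exact ⟨fun h hx => h (by rw [hx]), fun h hx => h (ψ.injective hx)⟩

/-- with exactly two `π`-fixed points, `ψ²` fixes them -/
lemma comm_sq_apply_fixed (h2 : (univ.filter fun i => π i = i).card = 2) {u : ι} (hu : π u = u) : ψ (ψ u) = u := by
  have hfix : ∀ z, π z = z → π (ψ z) = ψ z := by
    intro z hz; rw [← Equiv.Perm.mul_apply, ← hc.eq, Equiv.Perm.mul_apply, hz]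
  by_cases h1 : ψ u = u
  · rw [h1, h1]
  by_contra hne
  have hne' : ψ (ψ u) ≠ ψ u := fun h => h1 (ψ.injective h)
  have hsub : ({u, ψ u, ψ (ψ u)} : Finset ι) ⊆ univ.filter fun i => π i = i := by
    intro z hz
    simp only [Finset.mem_insert, Finset.mem_singleton] at hz
    rw [Finset.mem_filter]
    rcases hz with rfl | rfl | rfl
    · exact ⟨Finset.mem_univ _, hu⟩
    · exact ⟨Finset.mem_univ _, hfix _ hu⟩
    · exact ⟨Finset.mem_univ _, hfix _ (hfix _ hu)⟩
  have hcard3 : ({u, ψ u, ψ (ψ u)} : Finset ι).card = 3 := by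
    rw [Finset.card_insert_of_notMem, Finset.card_insert_of_notMem, Finset.card_singleton]
    · simpa using hne'.symm
    · simp only [Finset.mem_insert, Finset.mem_singleton, not_or]
      exact ⟨fun h => h1 h.symm, fun h => hne h.symm⟩
  have := Finset.card_le_card hsub
  rw [hcard3, h2] at this
  omega

omit hc in
/-- every moved point lies on the `π`-cycle of a transversal element -/
lemma exists_rep_of_moved (T : Finset ι)
    (hT : ∀ f : ι → ℤ, ∑ y ∈ univ.filter (fun y => π y ≠ y), f y = ∑ t ∈ T, ∑ k ∈ Finset.range 333, f ((π ^ k) t))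
    {x : ι} (hx : π x ≠ x) : ∃ t ∈ T, ∃ k, k < 333 ∧ (π ^ k) t = x := by
  have h1 := card_orbitMap_fibre_eq_one π T (univ.filter fun y => π y ≠ y) hT
    (Finset.mem_filter.mpr ⟨Finset.mem_univ _, hx⟩)
  obtain ⟨q, hq⟩ := Finset.card_pos.mp (by rw [h1]; norm_num)
  rw [Finset.mem_filter, Finset.mem_product, Finset.mem_range] at hq
  exact ⟨q.1, hq.1.1, q.2, hq.1.2, hq.2⟩

omit [Fintype ι] [DecidableEq ι] hc in
/-- two points on the cycle of the same transversal element differ by a power of `π` -/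
lemma pow_of_same_rep (hπ : π ^ 333 = 1) {t x y : ι} {k l : ℕ} (hk : k < 333) (hx : (π ^ k) t = x) (hy : (π ^ l) t = y) :
    (π ^ (l + (333 - k))) x = y := by
  rw [← hx, ← Equiv.Perm.mul_apply, ← pow_add, show l + (333 - k) + k = l + 333 by omega, pow_add, hπ, mul_one, hy]

/-- **pigeonhole**: for a moved point `x₀` and a transversal of size `2`, `ψ² x₀ = π^c x₀` for some `c` -/
lemma comm_sq_pow_on_moved (hπ : π ^ 333 = 1) (T : Finset ι) (hT2 : T.card = 2)
    (hT : ∀ f : ι → ℤ, ∑ y ∈ univ.filter (fun y => π y ≠ y), f y = ∑ t ∈ T, ∑ k ∈ Finset.range 333, f ((π ^ k) t))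
    {x₀ : ι} (hx₀ : π x₀ ≠ x₀) : ∃ c : ℕ, ψ (ψ x₀) = (π ^ c) x₀ := by
  have hx₁ : π (ψ x₀) ≠ ψ x₀ := (comm_moved_iff hc x₀).mpr hx₀
  have hx₂ : π (ψ (ψ x₀)) ≠ ψ (ψ x₀) := (comm_moved_iff hc _).mpr hx₁
  obtain ⟨t₀, ht₀, k₀, hk₀, e₀⟩ := exists_rep_of_moved T hT hx₀
  obtain ⟨t₁, ht₁, k₁, hk₁, e₁⟩ := exists_rep_of_moved T hT hx₁
  obtain ⟨t₂, ht₂, k₂, hk₂, e₂⟩ := exists_rep_of_moved T hT hx₂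
  -- from ψ x₀ = π^c x₀ the claim follows
  have case01 : ∀ c : ℕ, ψ x₀ = (π ^ c) x₀ → ∃ c' : ℕ, ψ (ψ x₀) = (π ^ c') x₀ := by
    intro c h
    refine ⟨c + c, ?_⟩
    rw [h, comm_apply_pow_orbit hc h c, ← Equiv.Perm.mul_apply, ← pow_add]
  obtain ⟨a, b, hab, hTab⟩ := Finset.card_eq_two.mp hT2
  have mem2 : ∀ t ∈ T, t = a ∨ t = b := fun t ht => by simpa [hTab] using ht
  -- pigeonhole on the three representatives
  have key : t₀ = t₁ ∨ t₀ = t₂ ∨ t₁ = t₂ := by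
    rcases mem2 t₀ ht₀ with rfl | rfl <;> rcases mem2 t₁ ht₁ with rfl | rfl <;>
      rcases mem2 t₂ ht₂ with rfl | rfl <;> simp
  rcases key with h01 | h02 | h12
  · subst h01
    exact case01 _ (pow_of_same_rep hπ hk₀ e₀ e₁).symm
  · subst h02
    exact ⟨_, (pow_of_same_rep hπ hk₀ e₀ e₂).symm⟩
  · subst h12
    have h := pow_of_same_rep hπ hk₁ e₁ e₂   -- π^c (ψ x₀) = ψ (ψ x₀)
    -- ψ (ψ x₀) = π^c (ψ x₀) = ψ (π^c x₀) ⇒ ψ x₀ = π^c x₀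
    have h' : ψ x₀ = (π ^ (k₂ + (333 - k₁))) x₀ := by
      apply ψ.injective
      rw [← h, ← Equiv.Perm.mul_apply, ← Equiv.Perm.mul_apply, (hc.pow_right _).eq]
    exact case01 _ h'

/-- a commuting permutation which is a power of `π` on both transversal cycles and fixes the `π`-fixed points has `333`rd power `1` -/
lemma comm_pow333_eq_one (hπ : π ^ 333 = 1) (T : Finset ι)
    (hT : ∀ f : ι → ℤ, ∑ y ∈ univ.filter (fun y => π y ≠ y), f y = ∑ t ∈ T, ∑ k ∈ Finset.range 333, f ((π ^ k) t))
    (hF : ∀ u, π u = u → ψ u = u) (hpow : ∀ t ∈ T, ∃ c : ℕ, ψ t = (π ^ c) t) : ψ ^ 333 = 1 := by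
  ext x
  rw [Equiv.Perm.one_apply]
  by_cases hx : π x = x
  · exact perm_pow_apply_of_fixed ψ (hF x hx) 333
  · obtain ⟨t, ht, k, -, rfl⟩ := exists_rep_of_moved T hT hx
    obtain ⟨c, hct⟩ := hpow t ht
    rw [comm_pow_apply_pow_orbit hc hct 333 k, ← Equiv.Perm.mul_apply, ← pow_add,
      show 333 * c + k = k + 333 * c by ring, pow_add, pow_mul, hπ, one_pow, mul_one]

end perm

/-! ### the census step: a signed automorphism of pair order dividing 333 fixing ≥ 335 rows is trivial -/

section census
variable {H : Matrix ι ι ℤ}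

/-- if the row part of a signed automorphism with `ψ^333 = χ^333 = 1` fixes at least `335` rows, the pair is trivial -/
lemma pair_eq_one_of_many_fixed (hH : IsHadamardMatrix H) (hι : Fintype.card ι = 668) {ψ χ : Equiv.Perm ι} {d e : ι → ℤ}
    (haut : IsSignedAut H ψ χ d e) (hψ : ψ ^ 333 = 1) (hχ : χ ^ 333 = 1)
    (hfix : 335 ≤ (univ.filter fun i => ψ i = i).card) : ψ = 1 ∧ χ = 1 := by
  have hcard : (Fintype.card ι : ℤ) ≠ 0 := by rw [hι]; norm_num
  set x : Equiv.Perm ι × Equiv.Perm ι := (ψ, χ) with hx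
  have hx333 : x ^ 333 = 1 := by rw [hx, Prod.pow_mk, hψ, hχ]; rfl
  have hdvd : orderOf x ∣ 333 := orderOf_dvd_of_pow_eq_one hx333
  -- powers of ψ fix at least what ψ fixes
  have hfixpow : ∀ j : ℕ, 335 ≤ (univ.filter fun i => (ψ ^ j) i = i).card := by
    intro j
    refine le_trans hfix (Finset.card_le_card fun i hi => ?_)
    rw [Finset.mem_filter] at hi ⊢
    exact ⟨hi.1, perm_pow_apply_of_fixed ψ hi.2 j⟩
  -- a power of pair order 37 or 3 is impossible
  have h37 : ∀ j : ℕ, orderOf ((ψ ^ j, χ ^ j) : Equiv.Perm ι × Equiv.Perm ι) = 37 → False := by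
    intro j hj
    obtain ⟨h1, h2, h3⟩ := pow_data_of_orderOf hj (a := 1) Nat.one_pos (by norm_num)
    rw [pow_one, pow_one] at h3
    have h := (hadamard668_fixedRows_37 hH hι (ψ ^ j) (χ ^ j) _ _ (isSignedAut_pow haut j) h1 h2 h3).1
    have := hfixpow j
    omega
  have h3 : ∀ j : ℕ, orderOf ((ψ ^ j, χ ^ j) : Equiv.Perm ι × Equiv.Perm ι) = 3 → False := by
    intro j hj
    obtain ⟨h1, h2, h3'⟩ := pow_data_of_orderOf hj (a := 1) Nat.one_pos (by norm_num)
    rw [pow_one, pow_one] at h3'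
    by_cases hψ1 : ψ ^ j = 1
    · have hautj := isSignedAut_pow haut j
      rw [hψ1] at hautj
      have := signedAut_snd_eq_one H hH hcard hautj (by decide : Odd 3) h2
      rcases h3' with h | h
      · exact h hψ1
      · exact h this
    · have h := (census3 hH hι (isSignedAut_pow haut j) h1 h2 hψ1).2.2.1
      have := hfixpow j
      omega
  have hmem : orderOf x ∈ Nat.divisors 333 := Nat.mem_divisors.mpr ⟨hdvd, by norm_num⟩
  have hdiv : Nat.divisors 333 = {1, 3, 9, 37, 111, 333} := by decide
  rw [hdiv] at hmem
  simp only [Finset.mem_insert, Finset.mem_singleton] at hmem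
  have hx0 : orderOf x ≠ 0 := (orderOf_pos x).ne'
  have hpow : ∀ q : ℕ, q ∣ orderOf x → orderOf ((ψ ^ (orderOf x / q), χ ^ (orderOf x / q)) : Equiv.Perm ι × Equiv.Perm ι) = q := by
    intro q hq
    have := orderOf_pow_orderOf_div hx0 hq
    rwa [hx, Prod.pow_mk] at this
  rcases hmem with h | h | h | h | h | h
  · have h1 : x = 1 := orderOf_eq_one_iff.mp h
    rw [hx, Prod.mk_eq_one] at h1
    exact h1
  · exact (h3 _ (hpow 3 (by rw [h]))).elim
  · exact (h3 _ (hpow 3 (by rw [h]; norm_num))).elim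
  · exact (h37 _ (hpow 37 (by rw [h]))).elim
  · exact (h37 _ (hpow 37 (by rw [h]; norm_num))).elim
  · exact (h37 _ (hpow 37 (by rw [h]; norm_num))).elim

end census

/-! ### the theorem -/

section main
variable {H : Matrix ι ι ℤ}

/-- **An element of order 333 is self-centralising.**  For a signed automorphism `(π, κ, d, e)` of a Hadamard matrix of order `668`
with pair order `333` and any signed automorphism `(π', κ', d', e')` with `π'π = ππ'`, `κ'κ = κκ'`: `(π', κ') = (π^c, κ^c)` for
some `c`. -/
theorem hadamard668_order333_self_centralizing (hH : IsHadamardMatrix H) (hι : Fintype.card ι = 668)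
    {π κ π' κ' : Equiv.Perm ι} {d e d' e' : ι → ℤ} (haut : IsSignedAut H π κ d e)
    (hπ : π ^ 333 = 1) (hκ : κ ^ 333 = 1) (h111 : π ^ 111 ≠ 1 ∨ κ ^ 111 ≠ 1) (h9 : π ^ 9 ≠ 1 ∨ κ ^ 9 ≠ 1)
    (haut' : IsSignedAut H π' κ' d' e') (hcπ : Commute π' π) (hcκ : Commute κ' κ) :
    ∃ c : ℕ, π' = π ^ c ∧ κ' = κ ^ c := by
  obtain ⟨⟨hR2, hRfree⟩, hC2, hCfree⟩ := hadamard668_order333_orbitType hH hι π κ d e haut hπ hκ h111 h9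
  -- transversals of rows and columns (2 cycles each)
  have htr : ∀ ρ : Equiv.Perm ι, ρ ^ 333 = 1 → (univ.filter fun i => ρ i = i).card = 2 →
      (∀ x, ρ x ≠ x → ∀ k, 0 < k → k < 333 → (ρ ^ k) x ≠ x) →
      ∃ T : Finset ι, T.card = 2 ∧ (∀ t ∈ T, ρ t ≠ t) ∧
        ∀ f : ι → ℤ, ∑ y ∈ univ.filter (fun y => ρ y ≠ y), f y = ∑ t ∈ T, ∑ k ∈ Finset.range 333, f ((ρ ^ k) t) := by
    intro ρ hρ h2 hfree
    have hstab : ∀ y ∈ univ.filter (fun y => ρ y ≠ y), ρ y ∈ univ.filter (fun y => ρ y ≠ y) := by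
      intro y hy
      rw [Finset.mem_filter] at hy ⊢
      exact ⟨Finset.mem_univ _, fun h => hy.2 (ρ.injective h)⟩
    obtain ⟨T, hTsub, hTc, hTs⟩ := exists_free_transversal ρ (by norm_num : 0 < 333) _ (univ.filter fun y => ρ y ≠ y)
      le_rfl hstab (fun y _ => by rw [hρ, Equiv.Perm.one_apply]) (fun y hy => hfree y (Finset.mem_filter.mp hy).2)
    have hsplit := Finset.card_filter_add_card_filter_not (s := (univ : Finset ι)) (fun y => ρ y = y)
    rw [h2, Finset.card_univ, hι] at hsplit
    have hm : (univ.filter fun y => ¬ ρ y = y).card = 666 := by omega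
    have hm' : (univ.filter fun y => ρ y ≠ y).card = 666 := hm
    rw [hm'] at hTc
    exact ⟨T, by omega, fun t ht => (Finset.mem_filter.mp (hTsub ht)).2, hTs⟩
  obtain ⟨TR, hTR2, hTRmoved, hTRs⟩ := htr π hπ hR2 hRfree
  obtain ⟨TC, hTC2, hTCmoved, hTCs⟩ := htr κ hκ hC2 hCfree
  -- step (1): ψ² is a power of π on a row cycle
  have hc2π : Commute (π' ^ 2) π := hcπ.pow_left 2
  have hc2κ : Commute (κ' ^ 2) κ := hcκ.pow_left 2
  obtain ⟨t₁, ht₁⟩ : TR.Nonempty := Finset.card_pos.mp (by rw [hTR2]; norm_num)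
  obtain ⟨c, hc⟩ := comm_sq_pow_on_moved hcπ hπ TR hTR2 hTRs (hTRmoved t₁ ht₁)
  have hc' : (π' ^ 2) t₁ = (π ^ c) t₁ := by rw [pow_two, Equiv.Perm.mul_apply, hc]
  -- step (2): Ψ = τ⁴ σ^m with π^(2c+m) = 1, a = 2c mod 333, m + a = 333
  obtain ⟨a, m, ha333, hma333, h2cmq⟩ : ∃ a m : ℕ, a < 333 ∧ m + a = 333 ∧ 2 * c + m = 333 * (2 * c / 333 + 1) :=
    ⟨2 * c % 333, 333 - 2 * c % 333, Nat.mod_lt _ (by norm_num), by omega, by omega⟩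
  have h2cm : π ^ (2 * c + m) = 1 := by rw [h2cmq, pow_mul, hπ, one_pow]
  have hΨ := isSignedAut_mul (isSignedAut_pow haut' 4) (isSignedAut_pow haut m)
  -- row part fixes F ∪ orbit(t₁)
  have hψF : ∀ u, π u = u → (π' ^ 4 * π ^ m) u = u := by
    intro u hu
    rw [Equiv.Perm.mul_apply, perm_pow_apply_of_fixed π hu m, show (4 : ℕ) = 2 * 2 by norm_num, pow_mul, pow_two,
      Equiv.Perm.mul_apply]
    exact comm_sq_apply_fixed hc2π hR2 hu
  have hψorb : ∀ k, (π' ^ 4 * π ^ m) ((π ^ k) t₁) = (π ^ k) t₁ := by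
    intro k
    rw [Equiv.Perm.mul_apply, ← Equiv.Perm.mul_apply (π ^ m), ← pow_add, show (4 : ℕ) = 2 * 2 by norm_num, pow_mul,
      comm_pow_apply_pow_orbit hc2π hc' 2 (m + k), ← Equiv.Perm.mul_apply, ← pow_add,
      show 2 * c + (m + k) = k + (2 * c + m) by ring, pow_add, h2cm, mul_one]
  have hfix335 : 335 ≤ (univ.filter fun i => (π' ^ 4 * π ^ m) i = i).card := by
    have hsub : (univ.filter fun i => π i = i) ∪ orbFin π 333 t₁ ⊆ univ.filter fun i => (π' ^ 4 * π ^ m) i = i := by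
      intro x hx
      rw [Finset.mem_filter]
      refine ⟨Finset.mem_univ _, ?_⟩
      rcases Finset.mem_union.mp hx with h | h
      · exact hψF x (Finset.mem_filter.mp h).2
      · obtain ⟨k, -, rfl⟩ := Finset.mem_image.mp h
        exact hψorb k
    have hdisj : Disjoint (univ.filter fun i => π i = i) (orbFin π 333 t₁) := by
      rw [Finset.disjoint_left]
      intro x hx hx'
      obtain ⟨k, -, rfl⟩ := Finset.mem_image.mp hx'
      have hmv : π ((π ^ k) t₁) ≠ (π ^ k) t₁ := by
        rw [← Equiv.Perm.mul_apply, ← pow_succ', pow_succ, Equiv.Perm.mul_apply]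
        exact fun h => hTRmoved t₁ ht₁ ((π ^ k).injective h)
      exact hmv (Finset.mem_filter.mp hx).2
    have hcard := Finset.card_le_card hsub
    rw [Finset.card_union_of_disjoint hdisj, hR2, card_orbFin_of_free (hRfree t₁ (hTRmoved t₁ ht₁))] at hcard
    exact hcard
  -- both parts have 333rd power 1 (piecewise powers)
  have hψ333 : (π' ^ 4 * π ^ m) ^ 333 = 1 := by
    refine comm_pow333_eq_one ((hcπ.pow_left 4).mul_left (Commute.pow_left (Commute.refl π) m)) hπ TR hTRs hψF
      fun t ht => ?_
    obtain ⟨ct, hct⟩ := comm_sq_pow_on_moved hcπ hπ TR hTR2 hTRs (hTRmoved t ht)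
    have hct' : (π' ^ 2) t = (π ^ ct) t := by rw [pow_two, Equiv.Perm.mul_apply, hct]
    refine ⟨2 * ct + m, ?_⟩
    rw [Equiv.Perm.mul_apply, show (4 : ℕ) = 2 * 2 by norm_num, pow_mul, comm_pow_apply_pow_orbit hc2π hct' 2 m,
      ← Equiv.Perm.mul_apply, ← pow_add]
  have hχ333 : (κ' ^ 4 * κ ^ m) ^ 333 = 1 := by
    refine comm_pow333_eq_one ((hcκ.pow_left 4).mul_left (Commute.pow_left (Commute.refl κ) m)) hκ TC hTCs
      (fun u hu => ?_) fun t ht => ?_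
    · rw [Equiv.Perm.mul_apply, perm_pow_apply_of_fixed κ hu m, show (4 : ℕ) = 2 * 2 by norm_num, pow_mul, pow_two,
        Equiv.Perm.mul_apply]
      exact comm_sq_apply_fixed hc2κ hC2 hu
    · obtain ⟨ct, hct⟩ := comm_sq_pow_on_moved hcκ hκ TC hTC2 hTCs (hTCmoved t ht)
      have hct' : (κ' ^ 2) t = (κ ^ ct) t := by rw [pow_two, Equiv.Perm.mul_apply, hct]
      refine ⟨2 * ct + m, ?_⟩
      rw [Equiv.Perm.mul_apply, show (4 : ℕ) = 2 * 2 by norm_num, pow_mul, comm_pow_apply_pow_orbit hc2κ hct' 2 m,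
        ← Equiv.Perm.mul_apply, ← pow_add]
  obtain ⟨hψ1, hχ1⟩ := pair_eq_one_of_many_fixed hH hι hΨ hψ333 hχ333 hfix335
  -- so π'^4 = π^a, κ'^4 = κ^a
  have hma : π ^ m * π ^ a = 1 := by rw [← pow_add, hma333, hπ]
  have hma' : κ ^ m * κ ^ a = 1 := by rw [← pow_add, hma333, hκ]
  have hπ4 : π' ^ 4 = π ^ a := by
    calc π' ^ 4 = π' ^ 4 * (π ^ m * π ^ a) := by rw [hma, mul_one]
      _ = (π' ^ 4 * π ^ m) * π ^ a := by rw [mul_assoc]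
      _ = π ^ a := by rw [hψ1, one_mul]
  have hκ4 : κ' ^ 4 = κ ^ a := by
    calc κ' ^ 4 = κ' ^ 4 * (κ ^ m * κ ^ a) := by rw [hma', mul_one]
      _ = (κ' ^ 4 * κ ^ m) * κ ^ a := by rw [mul_assoc]
      _ = κ ^ a := by rw [hχ1, one_mul]
  -- step (3): ν = τ σ^b with a + 4 b ≡ 0 (mod 333)
  obtain ⟨b, q, hab⟩ : ∃ b q : ℕ, a + b * 4 = 333 * q := ⟨(333 - a) * 250, 1000 - 3 * a, by omega⟩
  have hν := isSignedAut_mul haut' (isSignedAut_pow haut b)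
  have hcνπ : Commute (π' * π ^ b) π := hcπ.mul_left (Commute.pow_left (Commute.refl π) b)
  have hcνκ : Commute (κ' * κ ^ b) κ := hcκ.mul_left (Commute.pow_left (Commute.refl κ) b)
  have hν4π : (π' * π ^ b) ^ 4 = 1 := by
    rw [(hcπ.pow_right b).mul_pow, hπ4, ← pow_mul, ← pow_add, hab, pow_mul, hπ, one_pow]
  have hν4κ : (κ' * κ ^ b) ^ 4 = 1 := by
    rw [(hcκ.pow_right b).mul_pow, hκ4, ← pow_mul, ← pow_add, hab, pow_mul, hκ, one_pow]
  have powfacts : ∀ {ρ σ₀ : Equiv.Perm ι}, Commute ρ σ₀ → ρ ^ 2 = 1 → σ₀ ^ 333 = 1 →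
      (ρ * σ₀) ^ 666 = 1 ∧ (ρ * σ₀) ^ 333 = ρ ∧ (ρ * σ₀) ^ 222 = σ₀ ^ 222 ∧ (ρ * σ₀) ^ 18 = σ₀ ^ 18 := by
    intro ρ σ₀ hcm h2 h333
    refine ⟨?_, ?_, ?_, ?_⟩
    · rw [hcm.mul_pow, show (666 : ℕ) = 2 * 333 by norm_num, pow_mul, h2, one_pow, one_mul, pow_mul', h333, one_pow]
    · rw [hcm.mul_pow, h333, mul_one, show (333 : ℕ) = 2 * 166 + 1 by norm_num, pow_add, pow_mul, h2, one_pow, one_mul,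
        pow_one]
    · show (ρ * σ₀) ^ (2 * 111) = σ₀ ^ (2 * 111)
      rw [hcm.mul_pow, pow_mul, h2, one_pow, one_mul]
    · show (ρ * σ₀) ^ (2 * 9) = σ₀ ^ (2 * 9)
      rw [hcm.mul_pow, pow_mul, h2, one_pow, one_mul]
  -- an involution pair commuting with σ gives an element of pair order 666: excluded
  have h222 : π ^ 222 ≠ 1 ∨ κ ^ 222 ≠ 1 := by
    rcases h111 with h | h
    · left; intro h'; apply h; rw [show π ^ 111 = π ^ 111 * π ^ 222 by rw [h', mul_one], ← pow_add, hπ]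
    · right; intro h'; apply h; rw [show κ ^ 111 = κ ^ 111 * κ ^ 222 by rw [h', mul_one], ← pow_add, hκ]
  have h18 : π ^ 18 ≠ 1 ∨ κ ^ 18 ≠ 1 := by
    rcases h9 with h | h
    · left; intro h'
      have hg : π ^ Nat.gcd 18 333 = 1 := pow_gcd_eq_one.mpr ⟨h', hπ⟩
      exact h (by simpa using hg)
    · right; intro h'
      have hg : κ ^ Nat.gcd 18 333 = 1 := pow_gcd_eq_one.mpr ⟨h', hκ⟩
      exact h (by simpa using hg)
  have hinv : ∀ {ω₁ ω₂ : Equiv.Perm ι} {dd ee : ι → ℤ}, IsSignedAut H ω₁ ω₂ dd ee → Commute ω₁ π → Commute ω₂ κ →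
      ω₁ ^ 2 = 1 → ω₂ ^ 2 = 1 → (ω₁ ≠ 1 ∨ ω₂ ≠ 1) → False := by
    intro ω₁ ω₂ dd ee hω hc₁ hc₂ h₁ h₂ hne
    have hprod := isSignedAut_mul hω haut
    obtain ⟨a666, a333, a222, a18⟩ := powfacts hc₁ h₁ hπ
    obtain ⟨b666, b333, b222, b18⟩ := powfacts hc₂ h₂ hκ
    refine no_hadamard668_signedAut_order_666 hH hι (ω₁ * π) (ω₂ * κ) _ _ hprod a666 b666 ?_ ?_ ?_
    · rw [a333, b333]; exact hne
    · rw [a222, b222]; exact h222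
    · rw [a18, b18]; exact h18
  -- ν² and ν
  have hν2 : (π' * π ^ b) ^ 2 = 1 ∧ (κ' * κ ^ b) ^ 2 = 1 := by
    by_contra hne
    rw [not_and_or] at hne
    refine hinv (isSignedAut_pow hν 2) (hcνπ.pow_left 2) (hcνκ.pow_left 2) ?_ ?_ hne
    · rw [← pow_mul]; exact hν4π
    · rw [← pow_mul]; exact hν4κ
  have hν1 : π' * π ^ b = 1 ∧ κ' * κ ^ b = 1 := by
    by_contra hne
    rw [not_and_or] at hne
    exact hinv hν hcνπ hcνκ hν2.1 hν2.2 hne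
  -- conclusion: π' = π^(332 b), the inverse of π^b
  refine ⟨332 * b, ?_, ?_⟩
  · have hb' : π ^ b * π ^ (332 * b) = 1 := by
      rw [← pow_add, show b + 332 * b = 333 * b by ring, pow_mul, hπ, one_pow]
    calc π' = π' * (π ^ b * π ^ (332 * b)) := by rw [hb', mul_one]
      _ = (π' * π ^ b) * π ^ (332 * b) := by rw [mul_assoc]
      _ = π ^ (332 * b) := by rw [hν1.1, one_mul]
  · have hb' : κ ^ b * κ ^ (332 * b) = 1 := by
      rw [← pow_add, show b + 332 * b = 333 * b by ring, pow_mul, hκ, one_pow]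
    calc κ' = κ' * (κ ^ b * κ ^ (332 * b)) := by rw [hb', mul_one]
      _ = (κ' * κ ^ b) * κ ^ (332 * b) := by rw [mul_assoc]
      _ = κ ^ (332 * b) := by rw [hν1.2, one_mul]

end main

end Summit.Ventures.DiscreteObjects.Hadamard
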